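import Summits.BirchSwinnertonDyer.BirchSwinnertonDyer.Theorems.CMKolyvaginAtInertTwoCMKolyvaginConjectureAtInertTwoEpsilonLineOnHTwo
import HarnessLib

/-!
# Route `CMKolyvaginAtInertTwo`, crux `CMKolyvaginConjectureAtInertTwo` (stmt-BirchSwinnertonDyer-24648),
# stub `stub_positiveDepth` — THE DEPTH-ONE CASE IS ONE STRICT STEP: with `2 ∥ P(1)`, the route's standing machine
# inputs at `2` and ONE `w(E)`-eigen Selmer class of order `≥ 4`, the crux's conclusion holds UP TO THE FRAME of the
# witnessing datum (repair census: the frame gap, kernel-located)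

Seat `leafhand-bsd-cmkolyvaginatinert-8` g0 (cell `bsd-eis`); helper `--supports stmt-BirchSwinnertonDyer-24648`.
THEOREMS ONLY: no definition, no named fact introduced, no `sorry`; no stub, crux or summit closed; BSD proved for no
curve.

WHAT.  `stub_positiveDepth` asks, on a frame `(Dt, β, ι)` of H₂ with `y_K = P(1)` of infinite order and `2 ∣ P(1)` in
`E(K[1])`, for a square-free product `n` of CM-inert Zhang–Kolyvagin primes and a datum `d : KolyvaginHeegnerData Dt β ι n`
with `P_d(n) ∉ 2E(K[n])`.  At EXACT depth `M₀ = 1` (`2 ∣ P(1)`, `4 ∤ P(1)`) Kolyvagin's descent needs exactly ONE strict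
step, and `…EpsilonLineOnHTwo` §6 (hand 7's converse on the stub's frame) supplies it from a Selmer-side trigger.  This file
records the resulting statement IN THE CRUX'S SHAPE:
* `exists_primeLevel_witness_upToFrame_of_exactDepth_one` — stub binders + `2 ∥ P(1)` + the route's standing machine
  inputs at `2` (Gross 3.7 (2) `h372` by name, Gross 5.3 binder `h53`, a conjugation `c ≠ 1`, the Cartan-type `z` with
  `hzfix`/`hcomm` at level `2^{M+1}`, ty2's reciprocity DATA `R`) + ONE class `s ∈ Sel_{2^M}(E/K)` with `c_* s = w(E)·s`
  and `2·s ≠ 0` ⟹ **there are a PRIME level `n = ℓ` (square-free; its one prime factor Zhang–Kolyvagin at `2` and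
  CM-inert), a frame `(Dt', β', ι')` and a datum `d : KolyvaginHeegnerData Dt' β' ι' ℓ` with `P_d(ℓ) ∉ 2E(K[ℓ])`** — the
  conclusion of `CMKolyvaginConjectureAtInertTwo` except that the datum lives on the frame `(Dt', β', ι')` returned by the
  machine (ty2's per-level tower choice), not necessarily on the given `(Dt, β, ι)`.
REPAIR CENSUS (what separates this from the stub at depth one, kernel-located): (α) the FRAME GAP — either refactor
the P2 assembly so that its tower lives on the given frame (host note n-g43-3), or prove frame-invariance of
«`2 ∣ P_e(ℓ)`» across `(Dt, β, ι) ↦ (Dt', β', ι')` (datum-invariance on a FIXED frame is hands 1/2's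
`two_dvd_derivedPoint_iff_of_data`; the frame change — `y_{−β} = ε·ȳ_β` up to torsion, `ι ↦ ι ∘ c`, `φ ↦ ±φ + t` — is
not in the tree), M-sized; (β) the SOURCE of the trigger `s` (census L2, research: `E(K)` feeds only the `ε = −w`-part and
the shared bit `2^{M−1}δ(g)`, which has `2s = 0`); (γ) depth `M₀ ≥ 2` needs the iteration (composite `n`, the `ε`-part
two-prime step) — research.
HONEST FRAMING.  A corollary of `…EpsilonLineOnHTwo` §6 at `M₀ = 1`; conditional on the machine inputs exactly like
hands 5–7; closes nothing.
References: [cite: McCallumLMS1991, §5 Prop. 5.2, Thm. 5.4] [cite: GrossLMS1991, Prop. 2.1 with §10, §3 (3.1)–(3.3), §4 (4.1)]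
[cite: WZhang2014, §3.7, Notations (xii)]
presearch: as `…EpsilonLineOnHTwo` (nothing printed at `p = 2`; Kolyvagin 1991 / McCallum §5 at odd `p`
[corpus: book:editornd-l-functions-arithmetic p0285–p0289]).
-/

set_option autoImplicit false
set_option linter.dupNamespace false -- the Theorems namespace repeats the summit name by design (D-0017)

noncomputable section
open scoped Classical
open Field NumberField IsDedekindDomain Function WeierstrassCurve
open Literature.NumberTheory.EllipticCurves
open Literature.NumberTheory.EllipticCurves.ModularForms
open Literature.NumberTheory.GaloisRepresentations
open Literature.NumberTheory.GaloisCohomology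
open Literature.NumberTheory.EllipticCurves.GrossLMS1991 (prop37_2_reductionCongruence_inert)

namespace Summit.BirchSwinnertonDyer.BirchSwinnertonDyer.Theorems.CMKolyvaginFirstDescentTwo

variable (W : WeierstrassCurve ℚ) [W.IsElliptic] [W.IsGloballyMinimal] [NeZero (W.conductorNorm ℤ)]
  {K : Type} [Field K] [NumberField K]

/-- **At exact depth one the crux's conclusion holds up to the frame, from ONE `w(E)`-eigen Selmer class of order `≥ 4`.**
Binders of `stub_positiveDepth` (`W` globally minimal with CM, `2` CM-inert, `ρ̄_{E,2}` onto, odd Tamagawa product; `K`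
imaginary quadratic, odd `d_K ≠ −3`, Heegner for `N_E`; `Dt, β, ι`, a conductor-`1` datum `d₁` with `P(1)` of infinite
order), EXACT depth one (`2 ∣ P(1)`, `4 ∤ P(1)` in `E(K[1])`), the route's standing machine inputs at `2` (`h372`, binder
`h53`, `c ≠ 1`, `z`/`hzfix`/`hcomm` at level `2^{M+1}`, reciprocity DATA `R`), and `s ∈ Sel_{2^M}(E/K)` with
`c_* s = w(E)·s`, `2·s ≠ 0`.  THEN: a square-free PRIME level `ℓ` whose (single) prime factor is a Zhang–Kolyvagin prime
at `2` and CM-inert, a frame `(Dt', β', ι')` and a datum `d` of conductor `ℓ` on it with `P_d(ℓ) ∉ 2E(K[ℓ])`.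
(`…EpsilonLineOnHTwo` §6 with `M₀ = 1`: `2^{1} ∤ P_d(ℓ)`.)  The datum is NOT asserted on `(Dt, β, ι)` — see the module
docstring's repair census (α). [cite: McCallumLMS1991, §5 Prop. 5.2, Thm. 5.4] [cite: GrossLMS1991, Prop. 2.1 with §10, §4 (4.1)] -/
theorem exists_primeLevel_witness_upToFrame_of_exactDepth_one
    (hCMW : W.HasCM) (hin : Rank1Residual.CMInert W 2) (hρ2 : W.HasSurjectiveModNGaloisRep 2)
    (hT : Odd W.tamagawaProduct)
    (hK : IsImaginaryQuadratic K) (hodd : Odd (NumberField.discr K)) (h3 : NumberField.discr K ≠ -3)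
    (hHe : SatisfiesHeegnerHypothesis (W.conductorNorm ℤ) K)
    (h372 : prop37_2_reductionCongruence_inert (W.conductorNorm ℤ) W K)
    (h53 : ∀ [W.IsElliptic] (_hK : IsImaginaryQuadratic K) (_hH : SatisfiesHeegnerHypothesis (W.conductorNorm ℤ) K)
      (Dt : ModularParametrizationData W (W.conductorNorm ℤ)) (β : ℤ) (ι : K →+* ℂ) {M : ℕ}
      (_hM : 1 ≤ M) {n : ℕ} (_hn : Squarefree n)
      (_hKol : ∀ q ∈ n.primeFactors, IsKolyvaginPrime (W.conductorNorm ℤ) W K 2 q ∧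
        FrobEqFrobInfty W K (2 ^ M) q)
      (d : (m : ℕ) → m ∣ n → KolyvaginHeegnerData Dt β ι m) (m : ℕ) (hm : m ∣ n)
      (τm : ringClassField K ι m ≃ₐ[ℚ] ringClassField K ι m),
      (∀ x : ringClassField K ι m, ((τm x : ringClassField K ι m) : ℂ) = starRingEnd ℂ x) →
      ∃ σ' ∈ ringClassGal ι m, IsOfFinAddOrder
        (pointGalHom W (ringClassField K ι m) τm (d m hm).y -
          (-W.rootNumber) • pointGalHom W (ringClassField K ι m) σ' (d m hm).y))
    {c : K ≃ₐ[ℚ] K} (hc : c ≠ 1)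
    (Dt : ModularParametrizationData W (W.conductorNorm ℤ)) (β : ℤ) (ι : K →+* ℂ)
    (d₁ : KolyvaginHeegnerData Dt β ι 1) (hy : ¬ IsOfFinAddOrder d₁.derivedPoint)
    (hpos : ∃ Q : (W.baseChange (ringClassField K ι 1)).toAffine.Point, (2 : ℤ) • Q = d₁.derivedPoint)
    (hnot4 : ¬ ∃ Q : (W.baseChange (ringClassField K ι 1)).toAffine.Point, (4 : ℤ) • Q = d₁.derivedPoint)
    {M : ℕ} (hM : 1 ≤ M) {z : absoluteGaloisGroup K}
    (hzfix : ∀ T : geomTorsion (W.baseChange K) ((2 : ℕ) : ℤ), z • T = T → T = 0)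
    (hcomm : ∀ π ∈ torsionFixing (W.baseChange K) ((2 : ℕ) : ℤ),
      ∀ T : geomTorsion (W.baseChange K) ((2 ^ (M + 1) : ℕ) : ℤ), π • z • T = z • π • T)
    (R : Rank1Residual.P2.KolyvaginMachine.ReciprocityFamily (W.conductorNorm ℤ) W K 2 fun _ ↦ True)
    {s : galH1Torsion (W.baseChange K) ((2 ^ M : ℕ) : ℤ)}
    (hs : s ∈ selmerGroup (W.baseChange K) ((2 ^ M : ℕ) : ℤ))
    (hsν : conjAct W c ((2 ^ M : ℕ) : ℤ) s = W.rootNumber • s)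
    (h2 : ((2 : ℕ) : ℤ) • s ≠ 0) :
    ∃ ℓ : ℕ, Squarefree ℓ ∧
      (∀ q ∈ ℓ.primeFactors, Zhang2014.IsKolyvaginPrime (W.conductorNorm ℤ) W K 2 q ∧ Rank1Residual.CMInert W q) ∧
      ∃ (Dt' : ModularParametrizationData W (W.conductorNorm ℤ)) (β' : ℤ) (ι' : K →+* ℂ)
        (d : KolyvaginHeegnerData Dt' β' ι' ℓ),
        ¬ ∃ Q : (W.baseChange (ringClassField K ι' ℓ)).toAffine.Point, (2 : ℤ) • Q = d.derivedPoint := by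
  -- exact depth `M₀ = 1` in the currency of `…EpsilonLineOnHTwo` §6
  have hdiv : ∃ Q : (W.baseChange (ringClassField K ι 1)).toAffine.Point,
      ((2 ^ 1 : ℕ) : ℤ) • Q = d₁.derivedPoint := by simpa using hpos
  have hndiv : ¬ ∃ Q : (W.baseChange (ringClassField K ι 1)).toAffine.Point,
      ((2 ^ (1 + 1) : ℕ) : ℤ) • Q = d₁.derivedPoint := by
    rintro ⟨Q, hQ⟩
    exact hnot4 ⟨Q, by norm_num at hQ; exact hQ⟩
  obtain ⟨ℓ, hZ, -, hcm, Dt', β', ι', e, he⟩ :=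
    exists_strictDescent_of_selmer_minus_two_zsmul_ne_zero_of_derivedPoint_one W hCMW hin hρ2 hT hK hodd h3 hHe h372
      h53 hc Dt β ι d₁ hy hdiv hndiv hM hzfix hcomm R hs hsν h2
  have hℓp : ℓ.Prime := hZ.1
  refine ⟨ℓ, hℓp.squarefree, fun q hq ↦ ?_, Dt', β', ι', e, ?_⟩
  · rw [hℓp.primeFactors, Finset.mem_singleton] at hq
    subst hq
    exact ⟨hZ, hcm⟩
  · rintro ⟨Q, hQ⟩
    exact he Q (by simpa using hQ)

end Summit.BirchSwinnertonDyer.BirchSwinnertonDyer.Theorems.CMKolyvaginFirstDescentTwo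

end
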